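import Mathlib
import HarnessLib
import Summits.Ventures.LatticeQCDFlow.Exactness.BestFisherSampler
import Summits.Ventures.LatticeQCDFlow.Exactness.GaussianLatitude

/-!
# The CP(N−1) link heat bath, end to end: `± arccos` of Best–Fisher's cosine is von Mises; mean shift and wrap

HONEST FRAMING: exact (Metropolis-corrected) sampling algorithms for lattice gauge theory;
figures of merit are autocorrelation/cost numbers at stated couplings and volumes; no
continuum-physics claim.

Venture `LatticeQCDFlow` (cell pub-lqcd), topic `Exactness`, FANOUT row 9 (eng-latcore, the
engine `latflow.core`).  NEW WORK of the cell over Mathlib and row 9's `BestFisherSampler.lean`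
(`loopLaw_bestFisher`), `GaussianLatitude.lean` (`lintegral_sin_mul_comp_cos`), `RejectionSampling`.
Nothing is cited as a fact.  Printed counterpart, NAMED ONLY: Best–Fisher 1979.

The last line of `rng_vonmises` (`cpn_kernel.c`; numpy `rng.vonmises` in `cpn_2d.heatbath_links`):
`th = acos(f); return (u₃ > 0.5) ? th : −th`.  In idealised arithmetic:

* `vonMisesLaw κ` — the (unnormalised) von Mises law `e^{κ cos φ} dφ` on `(−π, π)`;
* `lintegral_unitLaw_sign` — a fair sign from `u₃`;
* `lintegral_vmfCos_comp_arccos` — `∫_{(−1,1)} (1−w²)^{−1/2} e^{κw} g(arccos w) dw = ∫_{(0,π)} e^{κ cos φ} g(φ) dφ`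
  (`w = cos φ`, `dw = sin φ dφ`), and its reflection onto `(−π, 0)`;
* **`map_bfAngle`** — `((vmfCosLaw κ 1) ⊗ unitLaw).map (± arccos) = ½ • vonMisesLaw κ`;
* `vmfCosLaw_univ_ne_zero`, `vmfCosLaw_univ_ne_top`, **`isProbabilityMeasure_loopLaw_woodRound`**,
  **`isProbabilityMeasure_loopLaw_bestFisher`** — the target masses are non-zero and finite (one Wood round
  accepts with probability `woodConst · mass ≤ 1`), so BOTH ENGINE LOOPS (site: Wood; link: Best–Fisher)
  HALT ALMOST SURELY;
* **`map_bestFisherAngle`** — THE LINK HEAT BATH IS EXACT: for `κ > 0`,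
  `((loopLaw (bfRound κ (bfR κ))) ⊗ unitLaw).map (± arccos) = (vonMisesLaw κ ℝ)⁻¹ • vonMisesLaw κ`.

Then (§ Rotation, `cpn_kernel.c` mode 0 links: `φ = wrap(arg G + d)`):

* `wrapAngle` — the reduction `toIocMod 2π (−π)` into `(−π, π]`; identity on the window, `2π`-periodic,
  measurable (`x + ⌊(π − x)/2π⌋·2π`); `vonMisesLawAt κ φ₀` — `e^{κ cos(ψ − φ₀)} dψ` on `(−π, π]`;
* **`map_vonMisesLaw_shift_wrap`** — `(vonMisesLaw κ).map (θ ↦ wrap(φ₀ + θ)) = vonMisesLawAt κ φ₀`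
  (translate, then move the `2π`-window of a periodic integrand, `CircleUniformAngle.lintegral_Ioc_periodic`);
* **`map_bestFisher_link`** — THE LINK HEAT BATH WITH ITS MEAN IS EXACT: for `κ > 0` and every `φ₀`, the
  loop, the fair sign, `arccos`, the shift by `φ₀` and the wrap output EXACTLY
  `(vonMisesLawAt κ φ₀ ℝ)⁻¹ • vonMisesLawAt κ φ₀`, a probability law;
* **`map_uniformAngle_eq_vonMisesLaw_zero`** — the `κ < 1e−8` branch `2πu − π` is exact AT `κ = 0`.

NOT CLAIMED: `κ = 2Nβ|G|` and `φ₀ = arg G` as functions of the neighbours (bookkeeping of the action, typed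
on the LAW side in `Scoring/`), the `0 < κ < 1e−8` approximation, floating point (`acos` clamp), the value of
the mass (`π I₀(κ)`).  `wrapAngle` is the same `toIocMod` reduction as `HaraNorms.wrap`
(`Literature/Barriers/CriticalPhenomena/LaceExpansionXSpaceNormsTorus`) and `toCell`
(`Literature/MathematicalPhysics/KineticTheory/PhononLenardBalescuOperator`), restated in this namespace so
that the sampler files do not import the lace-expansion / kinetic-theory chains.
-/

namespace Summit.Ventures.LatticeQCDFlow.Exactness

open MeasureTheory Measure Set Real ProbabilityTheory
open scoped ENNReal

section BestFisherAngle

/-- The von Mises law with concentration `κ` and mean `0`, unnormalised: `e^{κ cos φ} dφ` on `(−π, π)`. -/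
noncomputable def vonMisesLaw (κ : ℝ) : Measure ℝ :=
  (volume.restrict (Ioo (-π) π)).withDensity fun φ => ENNReal.ofReal (Real.exp (κ * Real.cos φ))

/-- The engine's last step: `φ = arccos w` if `u₃ > 1/2`, else `−arccos w`. -/
noncomputable def bfAngle (p : ℝ × ℝ) : ℝ :=
  if (1 / 2 : ℝ) < p.2 then Real.arccos p.1 else -Real.arccos p.1

/-- `bfAngle` is measurable. -/
theorem measurable_bfAngle : Measurable bfAngle := by
  unfold bfAngle
  exact Measurable.ite (measurableSet_lt measurable_const measurable_snd)
    (Real.measurable_arccos.comp measurable_fst) (Real.measurable_arccos.comp measurable_fst).neg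

/-- **A fair sign**: `∫ g(± a) d unitLaw(u₃) = ½ g(−a) + ½ g(a)`. -/
theorem lintegral_unitLaw_sign (a : ℝ) (g : ℝ → ℝ≥0∞) :
    ∫⁻ u, g (if (1 / 2 : ℝ) < u then a else -a) ∂unitLaw = 2⁻¹ * g (-a) + 2⁻¹ * g a := by
  have hhalf : ENNReal.ofReal (1 / 2) = 2⁻¹ := by
    rw [one_div, ENNReal.ofReal_inv_of_pos two_pos, ENNReal.ofReal_ofNat]
  have hdisj : Disjoint (Ioc (0 : ℝ) (1 / 2)) (Ioo (1 / 2) 1) := by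
    rw [disjoint_left]
    exact fun u hu hu' => absurd hu.2 (not_le.mpr hu'.1)
  rw [lintegral_unitLaw, ← Ioc_union_Ioo_eq_Ioo (by norm_num : (0 : ℝ) ≤ 1 / 2) (by norm_num : (1 : ℝ) / 2 < 1),
    lintegral_union measurableSet_Ioo hdisj,
    setLIntegral_congr_fun measurableSet_Ioc (fun u hu => by rw [if_neg (not_lt.mpr hu.2)]),
    setLIntegral_congr_fun measurableSet_Ioo
      (fun u (hu : u ∈ Ioo (1 / 2 : ℝ) 1) => by rw [if_pos hu.1]),
    setLIntegral_const, setLIntegral_const, Real.volume_Ioc, Real.volume_Ioo, sub_zero,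
    show (1 : ℝ) - 1 / 2 = 1 / 2 by norm_num, hhalf, mul_comm (g (-a)), mul_comm (g a)]

/-- **`w = cos φ`**: `∫_{(−1,1)} (1−w²)^{−1/2} e^{κw} g(arccos w) dw = ∫_{(0,π)} e^{κ cos φ} g(φ) dφ`. -/
theorem lintegral_vmfCos_comp_arccos (κ : ℝ) (g : ℝ → ℝ≥0∞) :
    ∫⁻ w in Ioo (-1) 1, ENNReal.ofReal ((1 - w ^ 2) ^ ((1 : ℝ) / 2 - 1) * Real.exp (κ * w)) * g (Real.arccos w) =
      ∫⁻ φ in Ioo 0 π, ENNReal.ofReal (Real.exp (κ * Real.cos φ)) * g φ := by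
  rw [← lintegral_sin_mul_comp_cos]
  refine setLIntegral_congr_fun measurableSet_Ioo fun φ hφ => ?_
  have hsin : 0 < Real.sin φ := Real.sin_pos_of_pos_of_lt_pi hφ.1 hφ.2
  have hrpow : (1 - Real.cos φ ^ 2) ^ ((1 : ℝ) / 2 - 1) = (Real.sin φ)⁻¹ := by
    rw [show (1 : ℝ) - Real.cos φ ^ 2 = Real.sin φ ^ 2 by nlinarith [Real.sin_sq_add_cos_sq φ],
      show (1 : ℝ) / 2 - 1 = -(1 / 2) by norm_num, Real.rpow_neg (sq_nonneg _), ← Real.sqrt_eq_rpow,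
      Real.sqrt_sq hsin.le]
  rw [Real.arccos_cos hφ.1.le hφ.2.le, hrpow, ← mul_assoc, ← ENNReal.ofReal_mul hsin.le, ← mul_assoc,
    mul_inv_cancel₀ hsin.ne', one_mul]

/-- … and its reflection: `∫_{(−1,1)} (1−w²)^{−1/2} e^{κw} g(−arccos w) dw = ∫_{(−π,0)} e^{κ cos φ} g(φ) dφ`. -/
theorem lintegral_vmfCos_comp_neg_arccos (κ : ℝ) (g : ℝ → ℝ≥0∞) :
    ∫⁻ w in Ioo (-1) 1, ENNReal.ofReal ((1 - w ^ 2) ^ ((1 : ℝ) / 2 - 1) * Real.exp (κ * w)) * g (-Real.arccos w) =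
      ∫⁻ φ in Ioo (-π) 0, ENNReal.ofReal (Real.exp (κ * Real.cos φ)) * g φ := by
  rw [lintegral_vmfCos_comp_arccos κ (fun φ => g (-φ)),
    show Ioo (-π) 0 = Neg.neg '' Ioo 0 π by rw [image_neg_eq_neg, neg_Ioo, neg_zero],
    lintegral_image_eq_lintegral_abs_deriv_mul measurableSet_Ioo
      (fun φ _ => (hasDerivAt_neg φ).hasDerivWithinAt) neg_injective.injOn]
  refine setLIntegral_congr_fun measurableSet_Ioo fun φ _ => ?_
  rw [abs_neg, abs_one, ENNReal.ofReal_one, one_mul, Real.cos_neg]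

/-- `(−π, π) ∖ {0} = (−π, 0) ∪ (0, π)`. -/
theorem Ioo_neg_pi_pi_diff_zero : Ioo (-π) π \ {0} = Ioo (-π) 0 ∪ Ioo 0 π := by
  ext x
  simp only [mem_sdiff, mem_Ioo, mem_singleton_iff, mem_union]
  constructor
  · rintro ⟨⟨h1, h2⟩, h0⟩
    rcases lt_or_gt_of_ne h0 with h | h
    · exact Or.inl ⟨h1, h⟩
    · exact Or.inr ⟨h, h2⟩
  · rintro (⟨h1, h2⟩ | ⟨h1, h2⟩)
    · exact ⟨⟨h1, by linarith [Real.pi_pos]⟩, h2.ne⟩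
    · exact ⟨⟨by linarith [Real.pi_pos], h2⟩, h1.ne'⟩

/-- **`± arccos` of the von Mises cosine law, with a fair sign, is half the von Mises law**:
`((vmfCosLaw κ 1) ⊗ unitLaw).map bfAngle = ½ • vonMisesLaw κ`. -/
theorem map_bfAngle (κ : ℝ) :
    ((vmfCosLaw κ 1).prod unitLaw).map bfAngle = (2 : ℝ≥0∞)⁻¹ • vonMisesLaw κ := by
  haveI : SFinite (vmfCosLaw κ 1) := by unfold vmfCosLaw; infer_instance
  have hd : Measurable fun w : ℝ => ENNReal.ofReal ((1 - w ^ 2) ^ ((1 : ℝ) / 2 - 1) * Real.exp (κ * w)) := by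
    fun_prop
  refine Measure.ext_of_lintegral _ fun g hg => ?_
  rw [lintegral_map hg measurable_bfAngle,
    lintegral_prod (fun z : ℝ × ℝ => g (bfAngle z)) (hg.comp measurable_bfAngle).aemeasurable]
  simp only [bfAngle]
  simp_rw [lintegral_unitLaw_sign]
  have hm1 : Measurable fun x : ℝ => g (-Real.arccos x) := hg.comp Real.measurable_arccos.neg
  have hm2 : Measurable fun x : ℝ => g (Real.arccos x) := hg.comp Real.measurable_arccos
  rw [lintegral_add_left (f := fun x : ℝ => 2⁻¹ * g (-Real.arccos x)) (hm1.const_mul _),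
    lintegral_const_mul _ (f := fun x : ℝ => g (-Real.arccos x)) hm1,
    lintegral_const_mul _ (f := fun x : ℝ => g (Real.arccos x)) hm2,
    vmfCosLaw, lintegral_withDensity_eq_lintegral_mul _ hd (g := fun x : ℝ => g (-Real.arccos x)) hm1,
    lintegral_withDensity_eq_lintegral_mul _ hd (g := fun x : ℝ => g (Real.arccos x)) hm2]
  simp only [Pi.mul_apply]
  rw [lintegral_vmfCos_comp_neg_arccos κ g, lintegral_vmfCos_comp_arccos κ g, ← mul_add,
    ← lintegral_union measurableSet_Ioo
      (disjoint_left.mpr fun x (hx : x ∈ Ioo (-π) 0) (hx' : x ∈ Ioo 0 π) => absurd hx.2 (not_lt.mpr hx'.1.le)),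
    ← Ioo_neg_pi_pi_diff_zero,
    setLIntegral_congr (sdiff_ae_eq_self.mpr (measure_mono_null inter_subset_right (measure_singleton _))),
    lintegral_smul_measure, smul_eq_mul, vonMisesLaw, lintegral_withDensity_eq_lintegral_mul _ (by fun_prop) hg]
  simp only [Pi.mul_apply]

/-- The target mass is non-zero: the density `(1−w²)^{δ/2−1}e^{κw}` is positive on `(−1, 1)`. -/
theorem vmfCosLaw_univ_ne_zero (κ δ : ℝ) : vmfCosLaw κ δ univ ≠ 0 := by
  have hd : Measurable fun w : ℝ => ENNReal.ofReal ((1 - w ^ 2) ^ (δ / 2 - 1) * Real.exp (κ * w)) := by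
    fun_prop
  rw [vmfCosLaw, withDensity_apply _ MeasurableSet.univ, Measure.restrict_univ]
  refine ne_of_gt ((lintegral_pos_iff_support hd).mpr ?_)
  rw [Measure.restrict_apply' measurableSet_Ioo,
    inter_eq_right.mpr fun w hw => Function.mem_support.mpr (ENNReal.ofReal_pos.mpr (mul_pos
      (Real.rpow_pos_of_pos (by nlinarith [hw.1, hw.2]) _) (Real.exp_pos _))).ne',
    Real.volume_Ioo]
  exact ENNReal.ofReal_pos.mpr (by norm_num)

/-- The target masses are finite (`κ ≥ 0`, `δ > 0`): one Wood round (`WoodSampler.lean`) accepts with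
probability `woodConst · mass ≤ 1` and `woodConst ≠ 0`. -/
theorem vmfCosLaw_univ_ne_top {κ δ : ℝ} (hκ : 0 ≤ κ) (hδ : 0 < δ) : vmfCosLaw κ δ univ ≠ ∞ := by
  haveI : IsProbabilityMeasure (betaMeasure (δ / 2) (δ / 2)) :=
    isProbabilityMeasureBeta (by positivity) (by positivity)
  haveI : IsProbabilityMeasure ((betaMeasure (δ / 2) (δ / 2)).map (woodW (woodB κ δ))) :=
    isProbabilityMeasure_map (measurable_woodW _).aemeasurable
  haveI : IsProbabilityMeasure (woodRound κ δ) :=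
    isProbabilityMeasure_thinning _ (measurable_woodAccept κ δ) (woodAccept_le_one κ δ)
  have h : woodConst κ δ * vmfCosLaw κ δ univ ≤ 1 := by
    rw [← woodRound_accept hκ hδ]; exact prob_le_one
  intro htop
  rw [htop, ENNReal.mul_top (woodConst_ne_zero (κ := κ) hδ)] at h
  exact ENNReal.one_ne_top (top_le_iff.mp h)

/-- **Wood's loop halts almost surely** (`κ ≥ 0`, `δ > 0`; the `cpn_2d` SITE heat bath, `δ = 2N − 1`):
its output law `loopLaw (woodRound κ δ)` is a probability law. -/
theorem isProbabilityMeasure_loopLaw_woodRound {κ δ : ℝ} (hκ : 0 ≤ κ) (hδ : 0 < δ) :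
    IsProbabilityMeasure (loopLaw (woodRound κ δ)) := by
  rw [loopLaw_woodRound hκ hδ]
  exact ⟨by rw [Measure.smul_apply, smul_eq_mul,
    ENNReal.inv_mul_cancel (vmfCosLaw_univ_ne_zero κ δ) (vmfCosLaw_univ_ne_top hκ hδ)]⟩

/-- **The engine's Best–Fisher loop halts almost surely** (`κ > 0`): its output law is a probability law. -/
theorem isProbabilityMeasure_loopLaw_bestFisher {κ : ℝ} (hκ : 0 < κ) :
    IsProbabilityMeasure (loopLaw (bfRound κ (bfR κ))) := by
  rw [loopLaw_bestFisher hκ]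
  exact ⟨by rw [Measure.smul_apply, smul_eq_mul,
    ENNReal.inv_mul_cancel (vmfCosLaw_univ_ne_zero κ 1) (vmfCosLaw_univ_ne_top hκ.le one_pos)]⟩

/-- Total masses: `vonMisesLaw κ ℝ = 2 · vmfCosLaw κ 1 ℝ`. -/
theorem vonMisesLaw_univ (κ : ℝ) : vonMisesLaw κ univ = 2 * vmfCosLaw κ 1 univ := by
  haveI : SFinite (vmfCosLaw κ 1) := by unfold vmfCosLaw; infer_instance
  have h := congrArg (fun μ : Measure ℝ => μ univ) (map_bfAngle κ)
  simp only [Measure.map_apply measurable_bfAngle MeasurableSet.univ, preimage_univ, Measure.smul_apply,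
    smul_eq_mul] at h
  rw [← univ_prod_univ, Measure.prod_prod, measure_univ (μ := unitLaw), mul_one] at h
  rw [h, ← mul_assoc, ENNReal.mul_inv_cancel two_ne_zero ENNReal.ofNat_ne_top, one_mul]

/-- **THE CP(N−1) LINK HEAT BATH IS EXACT** (`κ > 0`): Best–Fisher's loop with the engine's `r`,
a fair sign and `arccos` output EXACTLY the normalised von Mises law
`(vonMisesLaw κ ℝ)⁻¹ • vonMisesLaw κ` on `(−π, π)`. -/
theorem map_bestFisherAngle {κ : ℝ} (hκ : 0 < κ) :
    ((loopLaw (bfRound κ (bfR κ))).prod unitLaw).map bfAngle = (vonMisesLaw κ univ)⁻¹ • vonMisesLaw κ := by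
  haveI : SFinite (vmfCosLaw κ 1) := by unfold vmfCosLaw; infer_instance
  rw [loopLaw_bestFisher hκ, Measure.prod_smul_left, Measure.map_smul, map_bfAngle, smul_smul,
    vonMisesLaw_univ, ENNReal.mul_inv (Or.inl two_ne_zero) (Or.inl ENNReal.ofNat_ne_top), mul_comm]

end BestFisherAngle

section Rotation

/-- The engine's reduction of an angle into the window `(−π, π]` (`toIocMod`; see the file header). -/
noncomputable def wrapAngle (x : ℝ) : ℝ := toIocMod Real.two_pi_pos (-π) x

/-- `wrapAngle x ∈ (−π, π]`. -/
theorem wrapAngle_mem (x : ℝ) : wrapAngle x ∈ Ioc (-π) π := by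
  have h := toIocMod_mem_Ioc Real.two_pi_pos (-π) x
  rw [show -π + 2 * π = π by ring] at h
  exact h

/-- `wrapAngle` is the identity on `(−π, π]`. -/
theorem wrapAngle_eq_self {x : ℝ} (hx : x ∈ Ioc (-π) π) : wrapAngle x = x := by
  rw [wrapAngle, toIocMod_eq_self, show -π + 2 * π = π by ring]
  exact hx

/-- `wrapAngle` is `2π`-periodic. -/
theorem wrapAngle_periodic : Function.Periodic wrapAngle (2 * π) :=
  toIocMod_periodic Real.two_pi_pos (-π)

/-- `wrapAngle x = x + ⌊(π − x)/(2π)⌋ · 2π`. -/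
theorem wrapAngle_eq_floor (x : ℝ) : wrapAngle x = x + (⌊(π - x) / (2 * π)⌋ : ℝ) * (2 * π) := by
  rw [wrapAngle, toIocMod, toIocDiv_eq_neg_floor, show -π + 2 * π - x = π - x by ring, neg_smul, sub_neg_eq_add,
    zsmul_eq_mul]

/-- `wrapAngle` is measurable. -/
theorem measurable_wrapAngle : Measurable wrapAngle := by
  have h : wrapAngle = fun x : ℝ => x + ((⌊(π - x) / (2 * π)⌋ : ℤ) : ℝ) * (2 * π) :=
    funext wrapAngle_eq_floor
  rw [h]
  refine measurable_id.add (Measurable.mul_const ?_ _)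
  exact (measurable_from_top (f := fun k : ℤ => (k : ℝ))).comp ((measurable_const.sub measurable_id).div_const _).floor

/-- The von Mises law with concentration `κ` and mean `φ₀` on the engine's window `(−π, π]`, unnormalised. -/
noncomputable def vonMisesLawAt (κ φ₀ : ℝ) : Measure ℝ :=
  (volume.restrict (Ioc (-π) π)).withDensity fun ψ => ENNReal.ofReal (Real.exp (κ * Real.cos (ψ - φ₀)))

/-- Translating a restricted Lebesgue integral: `∫_{(a,b]} F(φ₀ + θ) dθ = ∫_{(φ₀+a, φ₀+b]} F(ψ) dψ`. -/
theorem lintegral_Ioc_comp_add (F : ℝ → ℝ≥0∞) (φ₀ a b : ℝ) :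
    ∫⁻ θ in Ioc a b, F (φ₀ + θ) = ∫⁻ ψ in Ioc (φ₀ + a) (φ₀ + b), F ψ := by
  rw [← image_const_add_Ioc,
    lintegral_image_eq_lintegral_abs_deriv_mul measurableSet_Ioc (f := fun x : ℝ => φ₀ + x) (f' := fun _ => (1 : ℝ))
      (fun θ _ => ((hasDerivAt_id' θ).const_add φ₀).hasDerivWithinAt) (add_right_injective φ₀).injOn]
  simp only [abs_one, ENNReal.ofReal_one, one_mul]

/-- **Shift and wrap**: `(vonMisesLaw κ).map (θ ↦ wrap(φ₀ + θ)) = vonMisesLawAt κ φ₀`. -/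
theorem map_vonMisesLaw_shift_wrap (κ φ₀ : ℝ) :
    (vonMisesLaw κ).map (fun θ => wrapAngle (φ₀ + θ)) = vonMisesLawAt κ φ₀ := by
  have hm : Measurable fun θ : ℝ => wrapAngle (φ₀ + θ) := measurable_wrapAngle.comp (measurable_id.const_add φ₀)
  have hd : Measurable fun θ : ℝ => ENNReal.ofReal (Real.exp (κ * Real.cos θ)) := by fun_prop
  refine Measure.ext_of_lintegral _ fun g hg => ?_
  rw [lintegral_map hg hm, vonMisesLaw,
    lintegral_withDensity_eq_lintegral_mul _ hd (g := fun θ => g (wrapAngle (φ₀ + θ))) (hg.comp hm),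
    vonMisesLawAt, lintegral_withDensity_eq_lintegral_mul _ (by fun_prop) hg]
  simp only [Pi.mul_apply]
  -- the window `(−π, π)` may be closed on the right (a null point), then translated by `φ₀`
  rw [setLIntegral_congr Ioo_ae_eq_Ioc,
    show (fun θ : ℝ => ENNReal.ofReal (Real.exp (κ * Real.cos θ)) * g (wrapAngle (φ₀ + θ))) =
      fun θ => (fun ψ : ℝ => ENNReal.ofReal (Real.exp (κ * Real.cos (ψ - φ₀))) * g (wrapAngle ψ)) (φ₀ + θ) by
        funext θ; simp only [add_sub_cancel_left],
    lintegral_Ioc_comp_add (fun ψ : ℝ => ENNReal.ofReal (Real.exp (κ * Real.cos (ψ - φ₀))) * g (wrapAngle ψ))]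
  -- the translated integrand is `2π`-periodic: move the window back to `(−π, π]`, where `wrap = id`
  have hper : Function.Periodic
      (fun ψ : ℝ => ENNReal.ofReal (Real.exp (κ * Real.cos (ψ - φ₀))) * g (wrapAngle ψ)) (2 * π) := by
    intro ψ
    simp only
    rw [wrapAngle_periodic ψ, show ψ + 2 * π - φ₀ = (ψ - φ₀) + 2 * π by ring, Real.cos_add_two_pi]
  rw [show φ₀ + π = (φ₀ + -π) + 2 * π by ring, lintegral_Ioc_periodic hper (φ₀ + -π) (-π),
    show -π + 2 * π = π by ring]
  refine setLIntegral_congr_fun measurableSet_Ioc fun ψ hψ => ?_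
  rw [wrapAngle_eq_self hψ]

/-- Total masses agree: `vonMisesLawAt κ φ₀ ℝ = vonMisesLaw κ ℝ`. -/
theorem vonMisesLawAt_univ (κ φ₀ : ℝ) : vonMisesLawAt κ φ₀ univ = vonMisesLaw κ univ := by
  have hm : Measurable fun θ : ℝ => wrapAngle (φ₀ + θ) := measurable_wrapAngle.comp (measurable_id.const_add φ₀)
  rw [← map_vonMisesLaw_shift_wrap κ φ₀, Measure.map_apply hm MeasurableSet.univ, preimage_univ]

/-- **THE CP(N−1) LINK HEAT BATH WITH ITS MEAN IS EXACT** (`κ > 0`, any `φ₀`): Best–Fisher's loop with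
the engine's `r`, the fair sign, `arccos`, the shift by `φ₀` and the wrap into `(−π, π]` output EXACTLY the
normalised von Mises law with mean `φ₀`: `(vonMisesLawAt κ φ₀ ℝ)⁻¹ • vonMisesLawAt κ φ₀`. -/
theorem map_bestFisher_link {κ : ℝ} (hκ : 0 < κ) (φ₀ : ℝ) :
    (((loopLaw (bfRound κ (bfR κ))).prod unitLaw).map bfAngle).map (fun θ => wrapAngle (φ₀ + θ)) =
      (vonMisesLawAt κ φ₀ univ)⁻¹ • vonMisesLawAt κ φ₀ := by
  rw [map_bestFisherAngle hκ, Measure.map_smul, map_vonMisesLaw_shift_wrap, vonMisesLawAt_univ]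

/-- … and that output is a probability law (the loop halts almost surely, `BestFisherAngle.lean`). -/
theorem isProbabilityMeasure_bestFisher_link {κ : ℝ} (hκ : 0 < κ) (φ₀ : ℝ) :
    IsProbabilityMeasure ((((loopLaw (bfRound κ (bfR κ))).prod unitLaw).map bfAngle).map
      (fun θ => wrapAngle (φ₀ + θ))) := by
  haveI := isProbabilityMeasure_loopLaw_bestFisher hκ
  haveI : IsProbabilityMeasure (((loopLaw (bfRound κ (bfR κ))).prod unitLaw).map bfAngle) :=
    isProbabilityMeasure_map measurable_bfAngle.aemeasurable
  exact isProbabilityMeasure_map (measurable_wrapAngle.comp (measurable_id.const_add φ₀)).aemeasurable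

/-- `u ↦ 2πu − π` maps `(0, 1)` onto `(−π, π)`. -/
theorem image_uniformAngle : (fun u : ℝ => 2 * π * u - π) '' Ioo 0 1 = Ioo (-π) π := by
  ext x
  constructor
  · rintro ⟨u, hu, rfl⟩
    exact ⟨by nlinarith [hu.1, Real.pi_pos], by nlinarith [hu.2, Real.pi_pos]⟩
  · rintro ⟨h1, h2⟩
    refine ⟨(x + π) / (2 * π), ⟨div_pos (by linarith) Real.two_pi_pos,
      (div_lt_one Real.two_pi_pos).mpr (by linarith)⟩, ?_⟩
    field_simp
    ring

/-- **The `κ = 0` branch of `rng_vonmises`** (`TWO_PI·u − π`): exact at `κ = 0` — the uniform angle IS the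
normalised von Mises law with `κ = 0` on `(−π, π)`.  (For `0 < κ < 1e−8` the engine also takes this branch:
an APPROXIMATION, not claimed.) -/
theorem map_uniformAngle_eq_vonMisesLaw_zero :
    unitLaw.map (fun u : ℝ => 2 * π * u - π) = (vonMisesLaw 0 univ)⁻¹ • vonMisesLaw 0 := by
  have h0 : vonMisesLaw 0 = volume.restrict (Ioo (-π) π) := by
    rw [vonMisesLaw, show (fun φ : ℝ => ENNReal.ofReal (Real.exp (0 * Real.cos φ))) = 1 by
      funext φ; simp, withDensity_one]
  have hm : Measurable fun u : ℝ => 2 * π * u - π := by fun_prop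
  have h2π : ENNReal.ofReal (2 * π) ≠ 0 := (ENNReal.ofReal_pos.mpr Real.two_pi_pos).ne'
  rw [h0, Measure.restrict_apply_univ, Real.volume_Ioo, show π - -π = 2 * π by ring]
  refine Measure.ext_of_lintegral _ fun g hg => ?_
  rw [lintegral_map hg hm, lintegral_unitLaw, lintegral_smul_measure, smul_eq_mul, ← image_uniformAngle,
    lintegral_image_eq_lintegral_abs_deriv_mul measurableSet_Ioo (f := fun u : ℝ => 2 * π * u - π)
      (f' := fun _ => 2 * π) (fun u _ => (((hasDerivAt_id' u).const_mul (2 * π)).sub_const π |>.congr_deriv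
        (by ring)).hasDerivWithinAt)
      (fun a _ b _ h => by simpa [Real.pi_pos.ne', mul_comm] using h),
    lintegral_const_mul' _ _ ENNReal.ofReal_ne_top, abs_of_pos Real.two_pi_pos, ← mul_assoc,
    ENNReal.inv_mul_cancel h2π ENNReal.ofReal_ne_top, one_mul]

end Rotation

end Summit.Ventures.LatticeQCDFlow.Exactness
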